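import Mathlib.GroupTheory.Commutator.Basic
import Mathlib.GroupTheory.Subgroup.Center
import Mathlib.Algebra.Group.Subgroup.Ker
import Mathlib.Algebra.Group.Prod
import HarnessLib

/-!
# Homomorphisms agreeing modulo the centre: uniqueness of lifts to central extensions

Topic `Literature/GroupTheory`.  Theorem-only file (no named fact, no new notion, no instance):

* `MonoidHom.eq_of_forall_mul_inv_mem_center` — **two homomorphisms `K, J : P →* H` whose values differ
  by CENTRAL elements of `H`, which agree on a subgroup `N ≤ P` with `[P,P] ⊔ N = P`, are equal**
  (the ratio `p ↦ K p · (J p)⁻¹` is a homomorphism with central values, so it kills every commutator and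
  `N`, hence all of `P`);
* `commutator_sup_ker_prodMap_eq_top` — for surjections `p_j : M_j →* S_j` (`j = 1, 2`) onto PERFECT groups
  (`commutator S_j = ⊤`), the product `M₁ × M₂` is generated by its commutator subgroup and `ker (p₁ × p₂)`;
* `MonoidHom.eq_of_forall_mul_inv_mem_center_of_perfect` — the combination: two homomorphisms out of
  `M₁ × M₂` that differ by central elements and agree on `ker (p₁ × p₂)` are equal.

This is the group theory behind the uniqueness of the homomorphism
`j̃ : Mp(W₁) × Mp(W₂) → Mp(W₁ ⊕ W₂)` of metaplectic groups over its restriction to the central torus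
("deux tels homomorphismes diffèrent par un caractère de `Sp(W₁) × Sp(W₂)`", a perfect group for `F ≠ 𝔽₃`):
Mœglin–Vignéras–Waldspurger, LNM 1291, Chap. 2, II.1, Remarque (6); Harris–Kudla–Sweet, J. Amer. Math.
Soc. 9 (1996), (1.18) "canonical if we specify its restriction to `ℂ¹`".  The perfectness input there is
`Sp_{2n}(k) = [Sp_{2n}(k), Sp_{2n}(k)]` for a local field `k` (Margulis 1991, Chap. I, Cor. (2.3.2)(b)); it is
NOT part of this file, which is pure group theory.

## References

* [MoeglinVignerasWaldspurger1987] C. Mœglin, M.-F. Vignéras, J.-L. Waldspurger, *Correspondances de Howe sur un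
  corps p-adique*, LNM 1291 (1987), Chap. 2, II.1, Rem. (6) — the application.
* [HarrisKudlaSweet1996] M. Harris, S. Kudla, W. Sweet, *Theta dichotomy for unitary groups*, JAMS 9 (1996),
  (1.18) — the application.
* [Margulis1991] G. A. Margulis, *Discrete Subgroups of Semisimple Lie Groups* (1991), I.(2.3.2)(b) — the
  perfectness input of the application (not used here).
-/

namespace Literature.GroupTheory

/-- **Homomorphisms that differ by central elements and agree on a co-generating subgroup are equal.**
Let `K, J : P →* H` be group homomorphisms such that (i) `K p * (J p)⁻¹` is central in `H` for every `p`,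
(ii) `K = J` on a subgroup `N ≤ P`, and (iii) `commutator P ⊔ N = ⊤`.  Then `K = J`: the ratio
`p ↦ K p * (J p)⁻¹` is a homomorphism (its values are central), its kernel contains every commutator (central
values commute with everything) and `N`, hence is `⊤`. [folklore] -/
theorem _root_.MonoidHom.eq_of_forall_mul_inv_mem_center {P H : Type*} [Group P] [Group H]
    (K J : P →* H) (hc : ∀ p, K p * (J p)⁻¹ ∈ Subgroup.center H)
    (N : Subgroup P) (hN : ∀ n ∈ N, K n = J n) (hgen : commutator P ⊔ N = ⊤) : K = J := by
  -- the central ratio homomorphism `r p = K p * (J p)⁻¹`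
  let r : P →* H :=
    { toFun := fun p => K p * (J p)⁻¹
      map_one' := by simp
      map_mul' := fun p q => by
        have hq := Subgroup.mem_center_iff.mp (hc q)
        rw [map_mul, map_mul, mul_inv_rev]
        calc K p * K q * ((J q)⁻¹ * (J p)⁻¹)
            = K p * ((K q * (J q)⁻¹) * (J p)⁻¹) := by simp only [mul_assoc]
          _ = K p * ((J p)⁻¹ * (K q * (J q)⁻¹)) := by rw [← hq ((J p)⁻¹)]
          _ = K p * (J p)⁻¹ * (K q * (J q)⁻¹) := by simp only [mul_assoc] }
  have hr : ∀ p, r p = K p * (J p)⁻¹ := fun _ => rfl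
  have hcomm : commutator P ≤ r.ker := by
    rw [commutator_def, Subgroup.commutator_le]
    intro p _ q _
    rw [MonoidHom.mem_ker, map_commutatorElement, commutatorElement_eq_one_iff_mul_comm]
    exact Subgroup.mem_center_iff.mp (hc q) (r p)
  have hN' : N ≤ r.ker := by
    intro n hn
    rw [MonoidHom.mem_ker, hr, hN n hn, mul_inv_cancel]
  have hker : r.ker = ⊤ := top_le_iff.mp (hgen ▸ sup_le hcomm hN')
  ext p
  have hp : r p = 1 := by
    rw [← MonoidHom.mem_ker, hker]
    exact Subgroup.mem_top p
  exact mul_inv_eq_one.mp hp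

/-- **Generation by commutators and the kernel of a map onto perfect groups.**  If `p_j : M_j →* S_j`
(`j = 1, 2`) are surjective homomorphisms onto groups equal to their own commutator subgroups, then
`commutator (M₁ × M₂) ⊔ ker (p₁.prodMap p₂) = ⊤`: every `m_j` is a product of commutators times an element
of `ker p_j`. [folklore] -/
theorem commutator_sup_ker_prodMap_eq_top {M₁ M₂ S₁ S₂ : Type*}
    [Group M₁] [Group M₂] [Group S₁] [Group S₂] (p₁ : M₁ →* S₁) (p₂ : M₂ →* S₂)
    (h₁ : Function.Surjective p₁) (h₂ : Function.Surjective p₂)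
    (hp₁ : commutator S₁ = ⊤) (hp₂ : commutator S₂ = ⊤) :
    commutator (M₁ × M₂) ⊔ (p₁.prodMap p₂).ker = ⊤ := by
  rw [eq_top_iff]
  rintro ⟨m₁, m₂⟩ -
  obtain ⟨x, hx, hpx⟩ : ∃ x ∈ commutator M₁, p₁ x = p₁ m₁ := by
    have hm : p₁ m₁ ∈ (commutator M₁).map p₁ := by
      rw [commutator_def, Subgroup.map_commutator, Subgroup.map_top_of_surjective p₁ h₁,
        ← commutator_def, hp₁]
      exact Subgroup.mem_top _
    exact Subgroup.mem_map.mp hm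
  obtain ⟨y, hy, hpy⟩ : ∃ y ∈ commutator M₂, p₂ y = p₂ m₂ := by
    have hm : p₂ m₂ ∈ (commutator M₂).map p₂ := by
      rw [commutator_def, Subgroup.map_commutator, Subgroup.map_top_of_surjective p₂ h₂,
        ← commutator_def, hp₂]
      exact Subgroup.mem_top _
    exact Subgroup.mem_map.mp hm
  have hxy : ((x, y) : M₁ × M₂) ∈ commutator (M₁ × M₂) := by
    rw [commutator_def, ← Subgroup.top_prod_top, Subgroup.commutator_prod_prod, ← commutator_def,
      ← commutator_def]
    exact ⟨hx, hy⟩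
  have hn : ((x, y)⁻¹ * (m₁, m₂) : M₁ × M₂) ∈ (p₁.prodMap p₂).ker := by
    rw [MonoidHom.mem_ker, map_mul, map_inv, MonoidHom.prodMap_def]
    simp [hpx, hpy]
  have hmem := Subgroup.mul_mem_sup hxy hn
  rwa [mul_inv_cancel_left] at hmem

/-- **Uniqueness of lifts through a product of maps onto perfect groups.**  Let `p_j : M_j →* S_j`
(`j = 1, 2`) be surjections onto perfect groups and `K, J : M₁ × M₂ →* H` homomorphisms whose values differ
by central elements of `H` and which agree on `ker (p₁.prodMap p₂)`.  Then `K = J`.  (With `M_j → S_j` the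
metaplectic covers `Mp(W_j) → Sp(W_j)` over a local field `≠ 𝔽₃`, central kernel, and `H = Mp(W₁ ⊕ W₂)`: two
homomorphisms over the block-diagonal embedding with the same restriction to the centre coincide — MVW Chap. 2
II.1 Rem. (6), HKS (1.18).) [folklore] -/
theorem _root_.MonoidHom.eq_of_forall_mul_inv_mem_center_of_perfect {M₁ M₂ S₁ S₂ H : Type*}
    [Group M₁] [Group M₂] [Group S₁] [Group S₂] [Group H]
    (p₁ : M₁ →* S₁) (p₂ : M₂ →* S₂) (h₁ : Function.Surjective p₁) (h₂ : Function.Surjective p₂)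
    (hp₁ : commutator S₁ = ⊤) (hp₂ : commutator S₂ = ⊤)
    (K J : M₁ × M₂ →* H) (hc : ∀ m, K m * (J m)⁻¹ ∈ Subgroup.center H)
    (hker : ∀ m ∈ (p₁.prodMap p₂).ker, K m = J m) : K = J :=
  K.eq_of_forall_mul_inv_mem_center J hc _ hker (commutator_sup_ker_prodMap_eq_top p₁ p₂ h₁ h₂ hp₁ hp₂)

end Literature.GroupTheory
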